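import Literature.NumberTheory.Sieve.AsymptoticSieveForPrimesRough
import Literature.NumberTheory.Sieve.AsymptoticSieveForPrimesS1
import Literature.NumberTheory.Sieve.AsymptoticSieveForPrimesHolds
import HarnessLib

/-!
# Asymptotic sieve for primes under (B*): the term estimates (4.5), (5.1), (6.6) over the core regime (proofs)

Topic `Literature/NumberTheory/Sieve` (trunk T-SIEVE), first sequel of
`Literature.NumberTheory.Sieve.AsymptoticSieveForPrimesRough` (the language of FI's Theorem 1 with
the bilinear hypothesis (B) replaced by (B*), §10 of the source). Source: J. Friedlander,
H. Iwaniec, *Asymptotic sieve for primes*, Ann. of Math. 148 (1998) 1041–1065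
[FriedlanderIwaniecASP1998] (= arXiv:math/9811186), §4 (4.5), §5 (5.1), §6 (6.6), and §10 p. 1064:
"recall that (B) was used solely to estimate the sums `S₂` and `S₃` in Sections 7 and 8" — i.e. the
estimates of `T(x; y)`, `T(x; y, z)` and `S₁(x; y, z)` hold for a sequence satisfying the hypotheses
of Theorem 1 WITHOUT any bilinear hypothesis.

This file DISCHARGES the three named facts of `…Rough` that record this:

* `fi_asp_T_estimate_core_holds : fi_asp_T_estimate_core` — FI (4.5),
  `T(x; y) = HA(x) + O(A(x)(log x)^{-2})`, over `FIRegimeCore` (hypotheses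
  `FIAsymptoticSieveHypotheses A D δ Δ` for ARBITRARY parameter functions `δ, Δ`);
* `fi_asp_Tyz_estimate_core_holds : fi_asp_Tyz_estimate_core` — FI (5.1),
  `T(x; y, z) ≪ A(x)(log x)^{-2}`, over `FIRegimeCore`;
* `fi_asp_S1_estimate_core_holds : fi_asp_S1_estimate_core` — FI (6.6),
  `S₁(x; y, z) ≪ A(x) log log x / log x`, over `FIRegimeCore`.

The proofs are those of the tree's `fi_asp_T_estimate_of_cancellation` (`…T`),
`fi_asp_Tyz_estimate_of_cancellation` (`…Tyz`) and `fi_asp_S1_estimate_holds` (`…S1`) VERBATIM —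
as announced in the docstrings of the three `Prop`s in `…Rough`: those proofs read the parameter
functions `δ, Δ` only through the field `FIRegime.hyp`, never through clause (B), so they run
unchanged once the regime argument is generalised from `FIRegime` (`δ = (log x)^α`, `Δ = x^θ`) to
`FIRegimeCore` (`δ, Δ` free). The single textual change is in (6.6): the tree's proof reads the
inequalities `2 ≤ (log x)^α`, `2 ≤ x^θ` off the clause (R1) of the bundle (where they concern the
bundle's own `δ, Δ`); here they are supplied as the eventually-true facts they are (`α, θ > 0`).
The Möbius–density inputs (2.4) and (1.13)–(1.14) are the tree's theorems
`fi_moebius_density_cancellation_holds`, `fi_moebius_density_log_sum_holds` (`…Cancellation`,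
`…Holds`), so all three estimates are unconditional. Through `fi_asp_T_estimate_core.to_estimate`
etc. (`…Rough`) they re-prove the tree's `fi_asp_T_estimate`, `fi_asp_Tyz_estimate`,
`fi_asp_S1_estimate`.

These are three of the five term estimates needed for `fi_asymptotic_sieve_primes_rough_loglog`
(Theorem 1 under (B*), `…Rough`), the case of [FriedlanderIwaniecAnnals1998] Proposition 2.1 that
the tree applies to the squarefree-supported sequence `μ²(n) a_n`, `a_n = #{(a,c) : a² + c⁴ = n}`
(`…FriedlanderIwaniecPrimesSquarefreeProofs`); the remaining two, (7.2) and (8.5) under (B*) via the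
integrated form (B̃) of §10, are the subject of the sequels.

## References

* J. Friedlander, H. Iwaniec, *Asymptotic sieve for primes*, Ann. of Math. 148 (1998), 1041–1065,
  §4 (4.5), §5 (5.1), §6 (6.6), §10 p. 1064. [cite: FriedlanderIwaniecASP1998, (4.5), (5.1), (6.6), §10]

## Mathlib / tree search

Everything used is in the tree's series `AsymptoticSieveForPrimes{T, Tyz, S1, Reduction, Assembly,
Cancellation, Holds, Rough}` (`lean search 'fi_asp_T_estimate_core'`: only `…Rough`, the three
`Prop`s and their `to_estimate` corollaries; no discharge before this file).
-/

noncomputable section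

open Filter Finset
open scoped ArithmeticFunction.Moebius ArithmeticFunction.vonMangoldt ArithmeticFunction.zeta
  ArithmeticFunction.omega ArithmeticFunction.sigma

namespace Literature.NumberTheory.Sieve

open MeasureTheory
open scoped Topology

/-! ### (4.5) over the core regime -/

/-- **FI (4.5) over `FIRegimeCore`, from (2.4) and (1.13)–(1.14)**: for a sequence satisfying the
hypotheses of Theorem 1 with ARBITRARY bilinear parameters `δ, Δ` (so: without any use of (B)),
upper-bound sieve weights of sifting range `x^{θ₁}` and level `x^{θ/2}`, `0 < θ < 1/3`, and all
`y ∈ [Y, eY]`, `Y = x^{-θ/2}√D`: `|T(x; y) - HA(x)| ≤ K A(x)(log x)^{-2}` for large `x`. The proof is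
the tree's `fi_asp_T_estimate_of_cancellation` verbatim (FI §4: `T = T₁ + T₂`, partial summation
(4.2) with (4.3), the main terms by (2.4), the remainders by (R′) since `Δy < D`, and the complete
sum (4.4) evaluated as `-H[ν = 1]`). [cite: FriedlanderIwaniecASP1998, §4 (4.5) and §10 p. 1064] -/
theorem fi_asp_T_estimate_core_of_cancellation (h24 : fi_moebius_density_cancellation)
    (h13 : fi_moebius_density_log_sum) : fi_asp_T_estimate_core := by
  intro A D δ Δ α θ θ₁ lam H hreg hH
  classical
  have hhyp := hreg.hyp
  obtain ⟨K, hK⟩ := hhyp.2.2.2.1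
  obtain ⟨c₉, K₉, h19⟩ := hhyp.2.2.2.2.1
  obtain ⟨K₂₄, h24'⟩ := h24 A.density A.density_mult ⟨K, hK⟩ ⟨c₉, K₉, h19⟩
  have h13' := h13 A.density A.density_mult ⟨K, hK⟩ ⟨c₉, K₉, h19⟩ H hH
  obtain ⟨K_R, hR'⟩ := fi_reduced_remainder_bound_holds A D _ _ hhyp
  have hθ : 0 < θ := by linarith [hreg.θ₁_pos, hreg.θ₁_le]
  have hθ3 : θ < 1 / 3 := hreg.θ_lt
  set κ := 1 / 3 - θ with hκ
  have hκ0 : 0 < κ := by rw [hκ]; linarith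
  set K' := max K 0 with hK'
  set KR := max K_R 0 with hKR
  set E := Real.exp (2 * (|c₉| + |K₉| / Real.log 2 ^ 10) + 6 * K') with hE
  set C₁ := E * (|K₂₄| / κ ^ 6) with hC₁
  set C₂ := E * (|K₂₄| * (1 / κ ^ 6 + 3 / κ ^ 5)) with hC₂
  set C₃ := 3 * |K₂₄| / κ ^ 5 with hC₃
  have hK'0 : 0 ≤ K' := le_max_right _ _
  have hKR0 : 0 ≤ KR := le_max_right _ _
  have hE0 : 0 < E := Real.exp_pos _
  have hC₁0 : 0 ≤ C₁ := by positivity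
  have hC₂0 : 0 ≤ C₂ := by positivity
  have hC₃0 : 0 ≤ C₃ := by positivity
  refine ⟨2 * (C₁ + KR) + C₂ + C₃ + KR, ?_⟩
  have hR1 : ∀ᶠ x : ℝ in atTop, x ^ (2 / 3 : ℝ) < D x ∧ D x < x :=
    hhyp.2.2.2.2.2.2.1.mono fun x hx => ⟨hx.1, hx.2.1⟩
  filter_upwards [hreg.weights, hR', hR1, eventually_exp_mul_fiY_le_sqrt hθ hR1,
    eventually_ge_atTop (4 : ℝ), eventually_ge_atTop (Real.exp 1),
    (tendsto_rpow_atTop (half_pos hθ)).eventually_ge_atTop (Real.exp 2),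
    (tendsto_rpow_atTop hκ0).eventually_ge_atTop (Real.exp 1),
    (tendsto_rpow_atTop (show (0 : ℝ) < 1 / 3 by norm_num)).eventually_ge_atTop (Real.exp 2)]
    with x hw hRx hR1x heY hx4 hxe hxθ hxκ hx13
  intro y hYy hyY
  -- elementary facts about the parameters
  have he : (2 : ℝ) ≤ Real.exp 1 := by linarith [Real.add_one_le_exp (1 : ℝ)]
  have he12 : Real.exp 1 ≤ Real.exp 2 := Real.exp_le_exp.mpr (by norm_num)
  have hx0 : 0 < x := by linarith
  have hx1 : 1 ≤ x := by linarith
  have hlogx : 1 ≤ Real.log x := by rw [Real.le_log_iff_exp_le hx0]; exact hxe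
  have hlogx0 : 0 < Real.log x := by linarith
  have hD0 : 0 < D x := lt_trans (by positivity) hR1x.1
  set L := x ^ (θ / 2) with hLdef
  have hL0 : 0 < L := Real.rpow_pos_of_pos hx0 _
  have he2 : (2 : ℝ) ≤ Real.exp 2 := by linarith [Real.add_one_le_exp (2 : ℝ)]
  have hL2 : 2 ≤ L := he2.trans hxθ
  have hL1 : 1 ≤ L := by linarith
  have hLx : L ≤ x := by
    calc L = x ^ (θ / 2) := rfl
      _ ≤ x ^ (1 : ℝ) := Real.rpow_le_rpow_of_exponent_le hx1 (by linarith)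
      _ = x := Real.rpow_one x
  obtain ⟨hY0, hYge⟩ :=
    fiY_pos_and_ge (D := D) (θ := θ) (θ₁ := 1 / 3 - θ / 2) hx1 hR1x.1 le_rfl
  have hsplit : x ^ (1 / 3 - θ / 2 : ℝ) = x ^ κ * L := by
    rw [hLdef, ← Real.rpow_add hx0]
    congr 1
    rw [hκ]; ring
  have hYeL : Real.exp 1 * L ≤ fiY D θ x := by
    calc Real.exp 1 * L ≤ x ^ κ * L := mul_le_mul_of_nonneg_right hxκ hL0.le
      _ = x ^ (1 / 3 - θ / 2 : ℝ) := hsplit.symm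
      _ ≤ fiY D θ x := hYge
  have hsqrt_le : Real.sqrt x ≤ x := Real.sqrt_le_self_iff.mpr (Or.inr hx1)
  have heYx : Real.exp 1 * fiY D θ x ≤ x := heY.trans hsqrt_le
  have hy0 : 0 ≤ y := hY0.le.trans hYy
  have hyx : y ≤ x := hyY.trans heYx
  have hyeL : Real.exp 1 * L ≤ y := hYeL.trans hYy
  have hy2L : 2 * L ≤ y := le_trans (mul_le_mul_of_nonneg_right he hL0.le) hyeL
  have hye : Real.exp 1 ≤ y := by
    calc Real.exp 1 = Real.exp 1 * 1 := (mul_one _).symm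
      _ ≤ Real.exp 1 * L := mul_le_mul_of_nonneg_left hL1 (Real.exp_pos 1).le
      _ ≤ y := hyeL
  have hy1 : 1 ≤ y := by linarith
  -- `log (y/L) ≥ κ log x`, `log y ≥ κ log x`
  have hlogyL : κ * Real.log x ≤ Real.log (y / L) := by
    have h1 : x ^ κ ≤ y / L := by
      rw [le_div_iff₀ hL0]
      calc x ^ κ * L = x ^ (1 / 3 - θ / 2 : ℝ) := hsplit.symm
        _ ≤ fiY D θ x := hYge
        _ ≤ y := hYy
    have := Real.log_le_log (Real.rpow_pos_of_pos hx0 _) h1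
    rwa [Real.log_rpow hx0] at this
  have hκl0 : 0 < κ * Real.log x := mul_pos hκ0 hlogx0
  have hlogy : κ * Real.log x ≤ Real.log y :=
    hlogyL.trans (Real.log_le_log (by positivity) (div_le_self hy0 hL1))
  have hlogyx : Real.log y ≤ Real.log x := Real.log_le_log (by linarith) hyx
  have hlogL : Real.log L ≤ Real.log x := Real.log_le_log hL0 hLx
  have hLfloor2 : (2 : ℝ) ≤ (⌊L⌋₊ : ℕ) := by
    have : (2 : ℕ) ≤ ⌊L⌋₊ := Nat.le_floor (by exact_mod_cast hL2)
    exact_mod_cast this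
  have hlogLf : Real.log ⌊L⌋₊ ≤ Real.log x :=
    Real.log_le_log (by linarith) ((Nat.floor_le hL0.le).trans hLx)
  have hlogLf0 : 0 ≤ Real.log ⌊L⌋₊ := Real.log_nonneg (by linarith)
  -- the box `⌊y⌋ ⌊L⌋ ≤ e √D ≤ D`
  have hYdef : fiY D θ x = Real.sqrt (D x) / L := by rw [hLdef]; rfl
  have hsqrtD : Real.exp 2 ≤ Real.sqrt (D x) := by
    have h1 : Real.sqrt (x ^ (2 / 3 : ℝ)) < Real.sqrt (D x) := Real.sqrt_lt_sqrt (by positivity) hR1x.1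
    rw [Real.sqrt_eq_rpow, ← Real.rpow_mul hx0.le, show (2 / 3 : ℝ) * (1 / 2) = 1 / 3 by norm_num] at h1
    exact hx13.trans h1.le
  have hbox : (((⌊y⌋₊ * ⌊L⌋₊ : ℕ)) : ℝ) ≤ D x := by
    push_cast
    calc (⌊y⌋₊ : ℝ) * ⌊L⌋₊ ≤ y * L :=
          mul_le_mul (Nat.floor_le hy0) (Nat.floor_le hL0.le) (Nat.cast_nonneg _) hy0
      _ ≤ (Real.exp 1 * fiY D θ x) * L := mul_le_mul_of_nonneg_right hyY hL0.le
      _ = Real.exp 1 * Real.sqrt (D x) := by rw [hYdef]; field_simp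
      _ ≤ Real.sqrt (D x) * Real.sqrt (D x) :=
          mul_le_mul_of_nonneg_right (he12.trans hsqrtD) (Real.sqrt_nonneg _)
      _ = D x := Real.mul_self_sqrt hD0.le
  -- sizes and remainders
  have hlam1 : ∀ ν, |lam x ν| ≤ 1 := hw.abs_le_one
  have hA0 : 0 ≤ A.size x := by rw [hhyp.size_eq]; exact A.congrSum_nonneg 1 x
  have hAt : ∀ t : ℝ, t ≤ x → 0 ≤ A.size t ∧ A.size t ≤ A.size x := fun t ht => by
    rw [hhyp.size_eq, hhyp.size_eq]
    exact ⟨A.congrSum_nonneg 1 t, A.congrSum_mono 1 ht⟩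
  have hRem : ∀ t : ℝ, t ≤ x → ∑ d ∈ (Icc 1 ⌊D x⌋₊).filter Squarefree,
      (divisorCountK 5 d : ℝ) * |A.remainder d t| ≤ KR * A.size x / Real.log x ^ 3 := by
    intro t ht
    refine (hRx t ht).trans ?_
    exact div_le_div_of_nonneg_right (mul_le_mul_of_nonneg_right (le_max_left _ _) hA0)
      (by positivity)
  -- (a) the main terms of `T₁`: `≤ C₁ (log x)^{-4}`
  have hMT1 : |∑ ν ∈ (Icc 1 ⌊L⌋₊).filter Squarefree, (lam x ν : ℝ) * A.density ν *
      ∑ b ∈ (Icc 1 ⌊y⌋₊).filter Squarefree, (μ b : ℝ) * A.density (b / Nat.gcd b ν)| ≤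
      C₁ / Real.log x ^ 4 := by
    refine (abs_fi_T1_mainTerms_le A.density_mult hK h19 h24' hlam1 hL2 hy2L).trans ?_
    have h1 : Real.log ⌊L⌋₊ ^ 2 ≤ Real.log x ^ 2 := pow_le_pow_left₀ hlogLf0 hlogLf 2
    have h2 : |K₂₄| / Real.log (y / L) ^ 6 ≤ |K₂₄| / (κ * Real.log x) ^ 6 :=
      div_le_div_of_nonneg_left (abs_nonneg _) (pow_pos hκl0 6) (pow_le_pow_left₀ hκl0.le hlogyL 6)
    have h20 : 0 ≤ |K₂₄| / Real.log (y / L) ^ 6 :=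
      div_nonneg (abs_nonneg _) (pow_nonneg (hκl0.le.trans hlogyL) 6)
    calc E * Real.log ⌊L⌋₊ ^ 2 * (|K₂₄| / Real.log (y / L) ^ 6)
        ≤ E * Real.log x ^ 2 * (|K₂₄| / (κ * Real.log x) ^ 6) :=
          mul_le_mul (mul_le_mul_of_nonneg_left h1 hE0.le) h2 h20 (by positivity)
      _ = C₁ / Real.log x ^ 4 := by
          rw [hC₁]
          field_simp
  -- (b) the main terms of `T₂` against the complete sum: `≤ C₂ (log x)^{-3}`
  have hMT2 : |(∑ ν ∈ (Icc 1 ⌊L⌋₊).filter Squarefree, (lam x ν : ℝ) * A.density ν *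
      ∑ b ∈ (Icc 1 ⌊y⌋₊).filter Squarefree, (μ b : ℝ) * A.density (b / Nat.gcd b ν) * Real.log b) -
      ∑ b ∈ Icc 1 ⌊y⌋₊, (μ b : ℝ) * A.density b * Real.log b| ≤ C₂ / Real.log x ^ 3 := by
    refine (abs_fi_T2_mainTerms_sub_le A.density_mult hK h19 h24' hw.map_one hlam1 hL2 hyeL).trans ?_
    have h1 : Real.log ⌊L⌋₊ ^ 2 ≤ Real.log x ^ 2 := pow_le_pow_left₀ hlogLf0 hlogLf 2
    have hlyL0 : 0 < Real.log (y / L) := lt_of_lt_of_le hκl0 hlogyL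
    have h6 : Real.log L / Real.log (y / L) ^ 6 ≤ Real.log x / (κ * Real.log x) ^ 6 := by
      calc Real.log L / Real.log (y / L) ^ 6 ≤ Real.log x / Real.log (y / L) ^ 6 :=
            div_le_div_of_nonneg_right hlogL (by positivity)
        _ ≤ Real.log x / (κ * Real.log x) ^ 6 :=
            div_le_div_of_nonneg_left hlogx0.le (pow_pos hκl0 6) (pow_le_pow_left₀ hκl0.le hlogyL 6)
    have h5 : 3 / Real.log (y / L) ^ 5 ≤ 3 / (κ * Real.log x) ^ 5 :=
      div_le_div_of_nonneg_left (by norm_num) (pow_pos hκl0 5) (pow_le_pow_left₀ hκl0.le hlogyL 5)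
    have hpos : 0 ≤ Real.log L / Real.log (y / L) ^ 6 + 3 / Real.log (y / L) ^ 5 :=
      add_nonneg (div_nonneg (Real.log_nonneg hL1) (by positivity)) (by positivity)
    calc E * Real.log ⌊L⌋₊ ^ 2 *
          (|K₂₄| * (Real.log L / Real.log (y / L) ^ 6 + 3 / Real.log (y / L) ^ 5))
        ≤ E * Real.log x ^ 2 *
          (|K₂₄| * (Real.log x / (κ * Real.log x) ^ 6 + 3 / (κ * Real.log x) ^ 5)) :=
          mul_le_mul (mul_le_mul_of_nonneg_left h1 hE0.le)
            (mul_le_mul_of_nonneg_left (add_le_add h6 h5) (abs_nonneg _))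
            (mul_nonneg (abs_nonneg _) hpos) (by positivity)
      _ = C₂ / Real.log x ^ 3 := by
          rw [hC₂]
          field_simp
  -- (c) the complete sum against `-H`: `≤ C₃ (log x)^{-5}`
  have hQH : |(∑ b ∈ Icc 1 ⌊y⌋₊, (μ b : ℝ) * A.density b * Real.log b) + H| ≤ C₃ / Real.log x ^ 5 := by
    refine (abs_sum_moebius_density_log_add_le h24' h13' hye).trans ?_
    calc 3 * |K₂₄| / Real.log y ^ 5 ≤ 3 * |K₂₄| / (κ * Real.log x) ^ 5 :=
          div_le_div_of_nonneg_left (by positivity) (pow_pos hκl0 5) (pow_le_pow_left₀ hκl0.le hlogy 5)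
      _ = C₃ / Real.log x ^ 5 := by rw [hC₃, mul_pow, div_div]
  -- the decomposition `T = T₁ - T₂'`
  rw [A.fiT_eq_T1_sub_T2 (lam x) hy0]
  -- (d) `T₂' = A(x) · MT₂ + RT₂`
  have hT2 := hhyp.sum_phi_V_eq_main_add_rem hw hL0.le (fun b => (μ b : ℝ) * Real.log b) ⌊y⌋₊ x
  have hMT2eq := fi_pairMainTerms_eq A.density_mult (lam x) (fun b => (μ b : ℝ) * Real.log b) ⌊y⌋₊ ⌊L⌋₊
  have hMT2eq' : ∑ ν ∈ (Icc 1 ⌊L⌋₊).filter Squarefree, (lam x ν : ℝ) * A.density ν *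
        ∑ b ∈ (Icc 1 ⌊y⌋₊).filter Squarefree, (μ b : ℝ) * Real.log b * A.density (b / Nat.gcd b ν) =
      ∑ ν ∈ (Icc 1 ⌊L⌋₊).filter Squarefree, (lam x ν : ℝ) * A.density ν *
        ∑ b ∈ (Icc 1 ⌊y⌋₊).filter Squarefree, (μ b : ℝ) * A.density (b / Nat.gcd b ν) * Real.log b := by
    refine Finset.sum_congr rfl fun ν _ => ?_
    congr 1
    exact Finset.sum_congr rfl fun b _ => by ring
  have hφ₂ : ∀ b ∈ Icc 1 ⌊y⌋₊, |(μ b : ℝ) * Real.log b| ≤ Real.log x := by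
    intro b hb
    obtain ⟨hb1, hby⟩ := Finset.mem_Icc.mp hb
    have hb1r : (1 : ℝ) ≤ b := by exact_mod_cast hb1
    have hby' : (b : ℝ) ≤ y := (Nat.cast_le.mpr hby).trans (Nat.floor_le hy0)
    have hμ : |(μ b : ℝ)| ≤ 1 := by exact_mod_cast ArithmeticFunction.abs_moebius_le_one
    rw [abs_mul, abs_of_nonneg (Real.log_nonneg hb1r)]
    calc |(μ b : ℝ)| * Real.log b ≤ 1 * Real.log x :=
          mul_le_mul hμ ((Real.log_le_log (by linarith) hby').trans hlogyx) (Real.log_nonneg hb1r)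
            zero_le_one
      _ = Real.log x := one_mul _
  have hRT2 : |∑ b ∈ Icc 1 ⌊y⌋₊, ∑ ν ∈ Icc 1 ⌊L⌋₊,
      (if Squarefree (Nat.lcm b ν) then (μ b : ℝ) * Real.log b * (lam x ν : ℝ) *
        A.remainder (Nat.lcm b ν) x else 0)| ≤ Real.log x * (KR * A.size x / Real.log x ^ 3) :=
    (A.abs_pairRemTerms_le hlam1 hlogx0.le (φ := fun b => (μ b : ℝ) * Real.log b) hφ₂ hbox x).trans
      (mul_le_mul_of_nonneg_left (hRem x le_rfl) hlogx0.le)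
  -- (e) `T₁` by partial summation: all partial sums are `≤ B`
  set B := A.size x * (C₁ / Real.log x ^ 4) + 1 * (KR * A.size x / Real.log x ^ 3) with hB
  have hW : ∀ N : ℕ, N ≤ ⌊x⌋₊ →
      |∑ n ∈ Icc 1 N, A.a n * (sieveRho (lam x) n : ℝ) *
        (truncLE (μ : ArithmeticFunction ℝ) y * ζ) n| ≤ B := by
    intro N hN
    have hNx : (N : ℝ) ≤ x := (Nat.cast_le.mpr hN).trans (Nat.floor_le hx0.le)
    have hW1 : ∑ n ∈ Icc 1 N, A.a n * (sieveRho (lam x) n : ℝ) *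
        (truncLE (μ : ArithmeticFunction ℝ) y * ζ) n =
        A.rhoSum (lam x) (truncLE (μ : ArithmeticFunction ℝ) y * ζ) N := by
      rw [SieveSequence.rhoSum, Nat.floor_natCast]
    rw [hW1, A.rhoSum_truncLE_mul_zeta (lam x) _ hy0 N]
    simp only [ArithmeticFunction.intCoe_apply]
    have hdec := hhyp.sum_phi_V_eq_main_add_rem hw hL0.le (fun b => (μ b : ℝ)) ⌊y⌋₊ (N : ℝ)
    have hMT1eq := fi_pairMainTerms_eq A.density_mult (lam x) (fun b => (μ b : ℝ)) ⌊y⌋₊ ⌊L⌋₊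
    rw [hdec, hMT1eq]
    obtain ⟨hAN0, hANx⟩ := hAt N hNx
    have hμ1 : ∀ b ∈ Icc 1 ⌊y⌋₊, |(μ b : ℝ)| ≤ 1 := fun b _ => by
      exact_mod_cast ArithmeticFunction.abs_moebius_le_one
    have hR1 := (A.abs_pairRemTerms_le hlam1 zero_le_one (φ := fun b => (μ b : ℝ)) hμ1 hbox (N : ℝ)).trans
      (mul_le_mul_of_nonneg_left (hRem N hNx) zero_le_one)
    refine (abs_add_le _ _).trans (add_le_add ?_ hR1)
    rw [abs_mul, abs_of_nonneg hAN0]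
    exact mul_le_mul hANx hMT1 (abs_nonneg _) hA0
  have hT1 := abs_sum_Icc_mul_log_le hW
  have hB0 : 0 ≤ B := by positivity
  have hlogX : Real.log ⌊x⌋₊ ≤ Real.log x := by
    have hX1 : (1 : ℝ) ≤ ⌊x⌋₊ := by
      have : 1 ≤ ⌊x⌋₊ := Nat.le_floor (by exact_mod_cast hx1)
      exact_mod_cast this
    exact Real.log_le_log (by linarith) (Nat.floor_le hx0.le)
  have hT1' : |∑ n ∈ Icc 1 ⌊x⌋₊, A.a n * (sieveRho (lam x) n : ℝ) *
      (truncLE (μ : ArithmeticFunction ℝ) y * ζ) n * Real.log n| ≤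
      2 * (C₁ + KR) * A.size x / Real.log x ^ 2 := by
    refine hT1.trans ?_
    calc 2 * B * Real.log ⌊x⌋₊ ≤ 2 * B * Real.log x :=
          mul_le_mul_of_nonneg_left hlogX (by positivity)
      _ = 2 * C₁ * A.size x / Real.log x ^ 3 + 2 * KR * A.size x / Real.log x ^ 2 := by
          rw [hB]
          field_simp
      _ ≤ 2 * C₁ * A.size x / Real.log x ^ 2 + 2 * KR * A.size x / Real.log x ^ 2 :=
          add_le_add (mul_div_log_pow_le_of_two_le (by positivity) hA0 hlogx (by norm_num)) le_rfl
      _ = 2 * (C₁ + KR) * A.size x / Real.log x ^ 2 := by ring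
  -- (f) combine
  rw [hT2, hMT2eq, hMT2eq']
  set T1 := ∑ n ∈ Icc 1 ⌊x⌋₊, A.a n * (sieveRho (lam x) n : ℝ) *
      (truncLE (μ : ArithmeticFunction ℝ) y * ζ) n * Real.log n with hT1def
  set M2 := ∑ ν ∈ (Icc 1 ⌊L⌋₊).filter Squarefree, (lam x ν : ℝ) * A.density ν *
        ∑ b ∈ (Icc 1 ⌊y⌋₊).filter Squarefree, (μ b : ℝ) * A.density (b / Nat.gcd b ν) * Real.log b
    with hM2def
  set Q := ∑ b ∈ Icc 1 ⌊y⌋₊, (μ b : ℝ) * A.density b * Real.log b with hQdef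
  set R2 := ∑ b ∈ Icc 1 ⌊y⌋₊, ∑ ν ∈ Icc 1 ⌊L⌋₊,
      (if Squarefree (Nat.lcm b ν) then (μ b : ℝ) * Real.log b * (lam x ν : ℝ) *
        A.remainder (Nat.lcm b ν) x else 0) with hR2def
  have hsplit2 : T1 - (A.size x * M2 + R2) - H * A.size x =
      T1 - A.size x * (M2 - Q) - A.size x * (Q + H) - R2 := by ring
  rw [hsplit2]
  have h2 : |A.size x * (M2 - Q)| ≤ C₂ * A.size x / Real.log x ^ 2 := by
    rw [abs_mul, abs_of_nonneg hA0]
    calc A.size x * |M2 - Q| ≤ A.size x * (C₂ / Real.log x ^ 3) := mul_le_mul_of_nonneg_left hMT2 hA0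
      _ = C₂ * A.size x / Real.log x ^ 3 := by ring
      _ ≤ C₂ * A.size x / Real.log x ^ 2 := mul_div_log_pow_le_of_two_le hC₂0 hA0 hlogx (by norm_num)
  have h3 : |A.size x * (Q + H)| ≤ C₃ * A.size x / Real.log x ^ 2 := by
    rw [abs_mul, abs_of_nonneg hA0]
    calc A.size x * |Q + H| ≤ A.size x * (C₃ / Real.log x ^ 5) := mul_le_mul_of_nonneg_left hQH hA0
      _ = C₃ * A.size x / Real.log x ^ 5 := by ring
      _ ≤ C₃ * A.size x / Real.log x ^ 2 := mul_div_log_pow_le_of_two_le hC₃0 hA0 hlogx (by norm_num)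
  have h4 : |R2| ≤ KR * A.size x / Real.log x ^ 2 := by
    refine hRT2.trans (le_of_eq ?_)
    field_simp
  calc |T1 - A.size x * (M2 - Q) - A.size x * (Q + H) - R2|
      ≤ |T1| + |A.size x * (M2 - Q)| + |A.size x * (Q + H)| + |R2| := by
        have := abs_sub (T1 - A.size x * (M2 - Q) - A.size x * (Q + H)) R2
        have := abs_sub_sub_le T1 (A.size x * (M2 - Q)) (A.size x * (Q + H))
        linarith
    _ ≤ 2 * (C₁ + KR) * A.size x / Real.log x ^ 2 + C₂ * A.size x / Real.log x ^ 2 +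
          C₃ * A.size x / Real.log x ^ 2 + KR * A.size x / Real.log x ^ 2 :=
        add_le_add (add_le_add (add_le_add hT1' h2) h3) h4
    _ = (2 * (C₁ + KR) + C₂ + C₃ + KR) * A.size x / Real.log x ^ 2 := by ring

/-! ### (5.1) over the core regime -/

/-- **FI (5.1) over `FIRegimeCore`, from (2.4)**: for a sequence satisfying the hypotheses of
Theorem 1 with arbitrary bilinear parameters `δ, Δ`, weights of sifting range `x^{θ₁}` and level
`x^{θ/2}`, and all `y, z ∈ [Y, eY]`: `|T(x; y, z)| ≤ K A(x)(log x)^{-2}` for large `x`. The proof is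
the tree's `fi_asp_Tyz_estimate_of_cancellation` verbatim (FI §5: insert (1.7), main terms by (2.4)
and (1.8)–(1.9), remainders by (R′) since `yzΔ ≤ D`). [cite: FriedlanderIwaniecASP1998, §5 (5.1) and §10 p. 1064] -/
theorem fi_asp_Tyz_estimate_core_of_cancellation (h24 : fi_moebius_density_cancellation) :
    fi_asp_Tyz_estimate_core := by
  intro A D δ Δ α θ θ₁ lam hreg
  classical
  have hhyp := hreg.hyp
  obtain ⟨K, hK⟩ := hhyp.2.2.2.1
  obtain ⟨c₉, K₉, h19⟩ := hhyp.2.2.2.2.1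
  obtain ⟨K₂₄, h24'⟩ := h24 A.density A.density_mult ⟨K, hK⟩ ⟨c₉, K₉, h19⟩
  obtain ⟨K_R, hR'⟩ := fi_reduced_remainder_bound_holds A D _ _ hhyp
  have hθ : 0 < θ := by linarith [hreg.θ₁_pos, hreg.θ₁_le]
  have hθ3 : θ < 1 / 3 := hreg.θ_lt
  have hκ0 : 0 < 1 / 3 - θ := by linarith
  set K' := max K 0 with hK'
  set E := Real.exp (2 * (|c₉| + |K₉| / Real.log 2 ^ 10) + 6 * K') with hE
  set C₁ := E * (2 * |K₂₄| / (1 / 3 - θ) ^ 6 * ((K' + 1) * 3)) with hC₁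
  have hK'0 : 0 ≤ K' := le_max_right _ _
  have hE0 : 0 < E := Real.exp_pos _
  have hC₁0 : 0 ≤ C₁ := by positivity
  refine ⟨C₁ + K_R, ?_⟩
  have hR1 : ∀ᶠ x : ℝ in atTop, x ^ (2 / 3 : ℝ) < D x ∧ D x < x :=
    hhyp.2.2.2.2.2.2.1.mono fun x hx => ⟨hx.1, hx.2.1⟩
  filter_upwards [hreg.weights, hR', hR1, eventually_exp_mul_fiY_le_sqrt hθ hR1,
    eventually_ge_atTop (4 : ℝ), eventually_ge_atTop (Real.exp 1),
    (tendsto_rpow_atTop (half_pos hθ)).eventually_ge_atTop (Real.exp 2),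
    (tendsto_rpow_atTop hκ0).eventually_ge_atTop (2 : ℝ)]
    with x hw hRx hR1x heY hx4 hxe hxθ hxκ
  intro y hYy hyY z hYz hzY
  -- elementary facts about the parameters
  have hx0 : 0 < x := by linarith
  have hx1 : 1 ≤ x := by linarith
  have hlogx : 1 ≤ Real.log x := by rw [Real.le_log_iff_exp_le hx0]; exact hxe
  have hlogx0 : 0 < Real.log x := by linarith
  have hD0 : 0 < D x := lt_trans (by positivity) hR1x.1
  have hDx : D x ≤ x := hR1x.2.le
  set L := x ^ (θ / 2) with hLdef
  have hL0 : 0 < L := Real.rpow_pos_of_pos hx0 _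
  have he2 : (2 : ℝ) ≤ Real.exp 2 := by linarith [Real.add_one_le_exp (2 : ℝ)]
  have hL2 : 2 ≤ L := he2.trans hxθ
  have hLx : L ≤ x := by
    calc L = x ^ (θ / 2) := rfl
      _ ≤ x ^ (1 : ℝ) := Real.rpow_le_rpow_of_exponent_le hx1 (by linarith)
      _ = x := Real.rpow_one x
  obtain ⟨hY0, hYge⟩ :=
    fiY_pos_and_ge (D := D) (θ := θ) (θ₁ := 1 / 3 - θ / 2) hx1 hR1x.1 le_rfl
  have hsplit : x ^ (1 / 3 - θ / 2 : ℝ) = x ^ (1 / 3 - θ : ℝ) * L := by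
    rw [hLdef, ← Real.rpow_add hx0]
    congr 1
    ring
  have hY2L : 2 * L ≤ fiY D θ x := by
    calc 2 * L ≤ x ^ (1 / 3 - θ : ℝ) * L := mul_le_mul_of_nonneg_right hxκ hL0.le
      _ = x ^ (1 / 3 - θ / 2 : ℝ) := hsplit.symm
      _ ≤ fiY D θ x := hYge
  have hsqrt_le : Real.sqrt x ≤ x := Real.sqrt_le_self_iff.mpr (Or.inr hx1)
  have heYx : Real.exp 1 * fiY D θ x ≤ x := heY.trans hsqrt_le
  have hy0 : 0 ≤ y := hY0.le.trans hYy
  have hyx : y ≤ x := hyY.trans heYx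
  have hz0 : 0 ≤ z := hY0.le.trans hYz
  have hzx : z ≤ x := hzY.trans heYx
  have hz1 : 1 ≤ z := by linarith
  have hyL : 2 * L ≤ y := hY2L.trans hYy
  -- the box `⌊y⌋ ⌊z⌋ ⌊L⌋ ≤ e² Y² L = e² D / L ≤ D`
  have hYdef : fiY D θ x = Real.sqrt (D x) / L := by rw [hLdef]; rfl
  have hYY : fiY D θ x * fiY D θ x = D x / (L * L) := by
    rw [hYdef, div_mul_div_comm, Real.mul_self_sqrt hD0.le]
  have hexp : Real.exp 1 * Real.exp 1 = Real.exp 2 := by rw [← Real.exp_add]; norm_num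
  have hbox : (((⌊y⌋₊ * ⌊z⌋₊ * ⌊L⌋₊ : ℕ)) : ℝ) ≤ D x := by
    push_cast
    calc (⌊y⌋₊ : ℝ) * ⌊z⌋₊ * ⌊L⌋₊ ≤ y * z * L :=
          mul_le_mul (mul_le_mul (Nat.floor_le hy0) (Nat.floor_le hz0) (Nat.cast_nonneg _) hy0)
            (Nat.floor_le hL0.le) (Nat.cast_nonneg _) (mul_nonneg hy0 hz0)
      _ ≤ (Real.exp 1 * fiY D θ x) * (Real.exp 1 * fiY D θ x) * L :=
          mul_le_mul_of_nonneg_right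
            (mul_le_mul hyY hzY hz0 (mul_nonneg (Real.exp_pos 1).le hY0.le)) hL0.le
      _ = Real.exp 2 * (D x / (L * L)) * L := by rw [← hexp, ← hYY]; ring
      _ ≤ L * (D x / (L * L)) * L :=
          mul_le_mul_of_nonneg_right
            (mul_le_mul_of_nonneg_right hxθ (div_nonneg hD0.le (by positivity))) hL0.le
      _ = D x := by field_simp
  -- the decomposition, the main terms and the remainder terms
  have hlam1 : ∀ ν, |lam x ν| ≤ 1 := hw.abs_le_one
  have hdec := hhyp.fiTyz_eq_main_add_rem hw hy0 hyx hz0 hzx hL0.le hLx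
  have hMT := abs_fi_mainTerms_le A.density_mult hK h19 h24' hlam1 hL2 hyL hz1
  have hRT := A.abs_fiTyz_remTerms_le hlam1 hbox hDx
  have hRx' := hRx x le_rfl
  have hA0 : 0 ≤ A.size x := by rw [hhyp.size_eq]; exact A.congrSum_nonneg 1 x
  -- numerics of the main-term bound: `≤ C₁ / (log x)³`
  have hLfloor2 : (2 : ℝ) ≤ (⌊L⌋₊ : ℕ) := by
    have : (2 : ℕ) ≤ ⌊L⌋₊ := Nat.le_floor (by exact_mod_cast hL2)
    exact_mod_cast this
  have hlogL : Real.log ⌊L⌋₊ ≤ Real.log x :=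
    Real.log_le_log (by linarith) ((Nat.floor_le hL0.le).trans hLx)
  have hlogL0 : 0 ≤ Real.log ⌊L⌋₊ := Real.log_nonneg (by linarith)
  have hlogyL : (1 / 3 - θ) * Real.log x ≤ Real.log (y / L) := by
    have h1 : x ^ (1 / 3 - θ : ℝ) ≤ y / L := by
      rw [le_div_iff₀ hL0]
      calc x ^ (1 / 3 - θ : ℝ) * L = x ^ (1 / 3 - θ / 2 : ℝ) := hsplit.symm
        _ ≤ fiY D θ x := hYge
        _ ≤ y := hYy
    have := Real.log_le_log (Real.rpow_pos_of_pos hx0 _) h1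
    rwa [Real.log_rpow hx0] at this
  have hκl0 : 0 < (1 / 3 - θ) * Real.log x := mul_pos hκ0 hlogx0
  have hW0 : 0 ≤ Real.log z + Real.log 4 + Real.log L := by
    have h1 : 0 ≤ Real.log z := Real.log_nonneg hz1
    have h2 : 0 ≤ Real.log 4 := Real.log_nonneg (by norm_num)
    have h3 : 0 ≤ Real.log L := Real.log_nonneg (by linarith)
    linarith
  have hW : Real.log z + Real.log 4 + Real.log L ≤ 3 * Real.log x := by
    have h1 : Real.log z ≤ Real.log x := Real.log_le_log (by linarith) hzx
    have h2 : Real.log 4 ≤ Real.log x := Real.log_le_log (by norm_num) hx4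
    have h3 : Real.log L ≤ Real.log x := Real.log_le_log hL0 hLx
    linarith
  have hmain : E * Real.log ⌊L⌋₊ ^ 2 *
      (2 * |K₂₄| / Real.log (y / L) ^ 6 * ((K' + 1) * (Real.log z + Real.log 4 + Real.log L))) ≤
      C₁ / Real.log x ^ 3 := by
    have h1 : Real.log ⌊L⌋₊ ^ 2 ≤ Real.log x ^ 2 := pow_le_pow_left₀ hlogL0 hlogL 2
    have h2 : 2 * |K₂₄| / Real.log (y / L) ^ 6 ≤ 2 * |K₂₄| / ((1 / 3 - θ) * Real.log x) ^ 6 :=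
      div_le_div_of_nonneg_left (by positivity) (pow_pos hκl0 6)
        (pow_le_pow_left₀ hκl0.le hlogyL 6)
    have h3 : (K' + 1) * (Real.log z + Real.log 4 + Real.log L) ≤ (K' + 1) * (3 * Real.log x) :=
      mul_le_mul_of_nonneg_left hW (by positivity)
    have h20 : 0 ≤ 2 * |K₂₄| / Real.log (y / L) ^ 6 :=
      div_nonneg (by positivity) (pow_nonneg (hκl0.le.trans hlogyL) 6)
    calc E * Real.log ⌊L⌋₊ ^ 2 *
          (2 * |K₂₄| / Real.log (y / L) ^ 6 * ((K' + 1) * (Real.log z + Real.log 4 + Real.log L)))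
        ≤ E * Real.log x ^ 2 *
          (2 * |K₂₄| / ((1 / 3 - θ) * Real.log x) ^ 6 * ((K' + 1) * (3 * Real.log x))) :=
          mul_le_mul (mul_le_mul_of_nonneg_left h1 hE0.le)
            (mul_le_mul h2 h3 (mul_nonneg (by positivity) hW0) (h20.trans h2))
            (mul_nonneg h20 (mul_nonneg (by positivity) hW0)) (by positivity)
      _ = C₁ / Real.log x ^ 3 := by
          rw [hC₁]
          field_simp
  -- combine
  rw [hdec]
  refine abs_size_mul_add_le hA0 hC₁0 hlogx ?_ (hRT.trans (mul_le_mul_of_nonneg_left hRx' hlogx0.le))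
  rw [fi_mainTerms_eq A.density_mult (lam x) ⌊y⌋₊ ⌊z⌋₊ ⌊L⌋₊]
  exact hMT.trans hmain

/-! ### (6.6) over the core regime -/

/-- **FI (6.6) over `FIRegimeCore`** (discharge of `fi_asp_S1_estimate_core`): for a sequence
satisfying the hypotheses of Theorem 1 with arbitrary bilinear parameters `δ, Δ` and weights
satisfying the sieve bound of §6, `|S₁(x; y, z)| ≤ K A(x) log log x / log x` for all large `x`,
every admissible `s` and all `y, z ∈ [Y, eY]`. The proof is the tree's `fi_asp_S1_estimate_holds`
verbatim (FI §6: drop `μ(b)`, insert (1.7), (R′) for the remainders, the factorisation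
`A(x) L(x) M(x)`, `L ≪ log δ` by (1.9), `M ≪ (log Δ)⁻¹` by positivity, Rankin's trick and the sieve
bound), except that `2 ≤ (log x)^α` and `2 ≤ x^θ` are taken from `α, θ > 0` rather than from the
clause (R1) of the bundle. [cite: FriedlanderIwaniecASP1998, §6 (6.6) and §10 p. 1064] -/
theorem fi_asp_S1_estimate_core_holds : fi_asp_S1_estimate_core := by
  intro A D δ Δ α θ θ₁ lam hreg hBex
  classical
  obtain ⟨C, hBev⟩ := hBex
  have hα := hreg.α_pos
  have hθ₁ := hreg.θ₁_pos
  have hθ₁le := hreg.θ₁_le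
  have hθ3 := hreg.θ_lt
  have hθ : 0 < θ := by linarith
  have hhyp := hreg.hyp
  have hsize := hhyp.1
  obtain ⟨K₈, h18K⟩ := hhyp.2.2.2.1
  have h18 : ∀ p : ℕ, p.Prime → 0 ≤ A.density p ∧ A.density p < 1 := fun p hp =>
    ⟨(h18K p hp).1, (h18K p hp).2.1⟩
  obtain ⟨c₉, K₉, h19⟩ := hhyp.2.2.2.2.1
  have h16 : ∀ x : ℝ, ∀ d : ℕ, ¬Squarefree d → A.congrSum d x = 0 := fun x d hd => by
    rw [SieveSequence.congrSum]
    exact Finset.sum_eq_zero fun n hn =>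
      hhyp.a_eq_zero fun hsq => hd (hsq.squarefree_of_dvd (Finset.mem_filter.mp hn).2)
  -- (R1) together with `2 ≤ (log x)^α`, `2 ≤ x^θ` (eventually true; in `FIRegime` these are
  -- part of the clause (R1) for `δ = (log x)^α`, `Δ = x^θ`, here `δ, Δ` are arbitrary)
  have hR1 : ∀ᶠ x : ℝ in atTop,
      x ^ (2 / 3 : ℝ) < D x ∧ D x < x ∧ 2 ≤ Real.log x ^ α ∧ 2 ≤ x ^ θ := by
    filter_upwards [hhyp.2.2.2.2.2.2.1,
      ((tendsto_rpow_atTop hα).comp Real.tendsto_log_atTop).eventually_ge_atTop (2 : ℝ),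
      (tendsto_rpow_atTop hθ).eventually_ge_atTop (2 : ℝ)] with x hx hlx hxθ
    exact ⟨hx.1, hx.2.1, hlx, hxθ⟩
  obtain ⟨KR, hRp⟩ := fi_reduced_remainder_bound_holds A D _ _ hhyp
  -- the constants
  set C' := max C 0 with hC'
  have hC'0 : 0 ≤ C' := le_max_right _ _
  set C₀ := -c₉ + |K₉| / Real.log 2 ^ 10 with hC₀
  set KL := 4 * Real.log 64 + 8 * α + 8 * |K₉| with hKL
  set KM := 2 * C' * (Real.exp 1 * Real.exp C₀) / θ₁ with hKM
  have hKL0 : 0 ≤ KL := by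
    have : 0 ≤ Real.log 64 := Real.log_nonneg (by norm_num)
    positivity
  refine ⟨KL * KM + |KR|, ?_⟩
  -- eventual inequalities between the parameters
  have ev1 := eventually_log_rpow_le_mul_rpow α (s := 1 / 2) (c := 1 / 16) (by norm_num)
    (by norm_num)
  have ev2 := eventually_log_rpow_le_mul_rpow α (s := 1 / 4) (c := 1 / 8) (by norm_num)
    (by norm_num)
  have ev3 := eventually_log_rpow_le_mul_rpow α (s := 1 / 2 - θ / 2) (c := 1 / 16)
    (by linarith) (by norm_num)
  have ev4 := eventually_log_rpow_le_mul_rpow (2 * α) (s := θ₁) (c := 1 / 128) hθ₁ (by norm_num)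
  have ev5 := eventually_log_rpow_le_mul_rpow (3 * α) (s := 1 / 6 - θ / 2) (c := 1 / 512)
    (by linarith) (by norm_num)
  have ev6 := (tendsto_rpow_atTop hθ₁).eventually_ge_atTop (4 : ℝ)
  have ev7 := Real.tendsto_log_atTop.eventually_ge_atTop
    (max 4 (max (Real.exp 1) (2 * Real.log 2 / θ₁)))
  filter_upwards [hreg.weights, hBev, hRp, hR1, ev1, ev2, ev3, ev4, ev5, ev6, ev7,
    eventually_gt_atTop (1 : ℝ)] with x hwx hBx hRx hR1x hev1 hev2 hev3 hev4 hev5 hev6 hev7 hx1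
  intro s hs y hy1 hy2 z hz1 hz2
  -- basic quantities at `x`
  have hx0 : 0 < x := lt_trans one_pos hx1
  have hlog4 : 4 ≤ Real.log x := le_trans (le_max_left _ _) hev7
  have hloge : Real.exp 1 ≤ Real.log x :=
    le_trans ((le_max_left _ _).trans (le_max_right _ _)) hev7
  have hlogθ : 2 * Real.log 2 / θ₁ ≤ Real.log x :=
    le_trans ((le_max_right _ _).trans (le_max_right _ _)) hev7
  have hlog1 : 1 ≤ Real.log x := le_trans (by norm_num) hlog4
  have hlog0 : 0 < Real.log x := lt_of_lt_of_le one_pos hlog1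
  have hLL1 : 1 ≤ Real.log (Real.log x) := by
    rw [← Real.log_exp 1]
    exact Real.log_le_log (Real.exp_pos 1) hloge
  obtain ⟨U, hU⟩ : ∃ U : ℝ, U = Real.sqrt x / (8 * Real.log x ^ α) := ⟨_, rfl⟩
  obtain ⟨hU2, hU14, hUx, hLevU, hzLev, hRz, hD, hD0, hSY, hY0, hxU2⟩ :=
    fiS1_param_bounds (D := D) hθ₁le hx1 hR1x hev1 hev2 hev3 hev4 hev5 hU
  have hU0 : 0 < U := lt_of_lt_of_le two_pos hU2
  have hU1 : 1 ≤ U := le_trans one_le_two hU2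
  have hz4 : 4 ≤ x ^ θ₁ := hev6
  have hz0 : 0 < x ^ θ₁ := lt_of_lt_of_le four_pos hz4
  have hDx0 : 0 ≤ D x := hD0.le
  have hDx : D x ≤ x := hR1x.2.1.le
  -- `U < sy`, `U < sz`
  have hs0 : 0 < s := by
    obtain ⟨⟨k, rfl⟩, -, -⟩ := hs
    exact pow_pos two_pos k
  have hsU : U < s * fiY D θ x := by
    rw [← hSY]
    exact mul_lt_mul_of_pos_right hs.2.1 hY0
  have hsy : U < s * y := hsU.trans_le (mul_le_mul_of_nonneg_left hy1 hs0.le)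
  have hsz : U < s * z := hsU.trans_le (mul_le_mul_of_nonneg_left hz1 hs0.le)
  -- `ε = 1/log x`, the sieve bound with `C' ≥ 0`, (R′) at `t = x`, `A(x) ≥ 0`
  set ε := 1 / Real.log x with hε
  have hε0 : 0 < ε := one_div_pos.mpr hlog0
  have hε1 : ε ≤ 1 := (div_le_one hlog0).mpr hlog1
  have hBx' : ∑ d ∈ (primesProdBelow (x ^ θ₁)).divisors,
      (lam x d : ℝ) * ∏ p ∈ d.primeFactors, fiSieveDensity A.density ε p ≤
      C' * ∏ p ∈ Nat.primesBelow ⌈x ^ θ₁⌉₊, (1 - fiSieveDensity A.density ε p) := by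
    refine (hBx ε hε0 hε1).trans (mul_le_mul_of_nonneg_right (le_max_left _ _) ?_)
    exact Finset.prod_nonneg fun p hp => sub_nonneg.mpr
      (fiSieveDensity_le_one (h18 p (Nat.prime_of_mem_primesBelow hp)).1
        (h18 p (Nat.prime_of_mem_primesBelow hp)).2.le ε)
  have hRx' := hRx x le_rfl
  have hA0 : 0 ≤ A.size x := by
    rw [hsize]
    exact A.congrSum_nonneg 1 x
  -- the core estimate
  have core := abs_rhoSum_S1_le_core (A := A) hwx (h16 x) hA0 h18 h19 hRx' hε0 hC'0 hBx' hU2 hsy hsz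
    hUx hLevU hzLev hRz hz4 hD hDx0 hDx
  rw [SieveSequence.fiS1]
  refine core.trans ?_
  -- post-processing
  have hlogU : Real.log x / 4 ≤ Real.log U := by
    have := Real.log_le_log (Real.rpow_pos_of_pos hx0 _) hU14
    rwa [Real.log_rpow hx0, one_div_mul_eq_div] at this
  have hlogxU : Real.log (x / U) ≤ Real.log x :=
    Real.log_le_log (div_pos hx0 hU0) (div_le_self hx0.le hU1)
  have hxUU : U ≤ x / U := by
    rw [le_div_iff₀ hU0, ← sq]
    exact hUx
  have hlogxU0 : 0 ≤ Real.log (x / U) := Real.log_nonneg (hU1.trans hxUU)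
  have hdiff : Real.log (x / U) - Real.log U = Real.log 64 + 2 * α * Real.log (Real.log x) := by
    rw [← Real.log_div (div_pos hx0 hU0).ne' hU0.ne', div_div, ← sq, hxU2,
      Real.log_mul (by norm_num) (by positivity), ← Real.rpow_natCast,
      ← Real.rpow_mul hlog0.le, Real.log_rpow hlog0]
    push_cast
    ring
  have hLb := fiS1_L_final (K := K₉) hlog4 hLL1 hlogU hlogxU hlogxU0 hα hdiff
  have hRε0 : 0 ≤ (x / U ^ 2) ^ ε := Real.rpow_nonneg (div_nonneg hx0.le (sq_nonneg U)) _
  have hRε : (x / U ^ 2) ^ ε ≤ Real.exp 1 := by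
    have hRx1 : x / U ^ 2 ≤ x := by
      refine hRz.le.trans ?_
      calc x ^ θ₁ ≤ x ^ (1 : ℝ) := Real.rpow_le_rpow_of_exponent_le hx1.le (by linarith)
        _ = x := Real.rpow_one x
    calc (x / U ^ 2) ^ ε ≤ x ^ ε :=
          Real.rpow_le_rpow (div_nonneg hx0.le (sq_nonneg U)) hRx1 hε0.le
      _ = Real.exp 1 := by
          rw [Real.rpow_def_of_pos hx0, hε, mul_one_div_cancel hlog0.ne']
  have hlogz : θ₁ * Real.log x / 2 ≤ Real.log (x ^ θ₁ / 2) := by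
    rw [Real.log_div hz0.ne' (by norm_num), Real.log_rpow hx0]
    have h2 : 2 * Real.log 2 ≤ θ₁ * Real.log x := by
      have := (div_le_iff₀ hθ₁).mp hlogθ
      linarith
    linarith
  have hMb := fiS1_M_final (C₀ := C₀) hlog0 hθ₁ hC'0 hRε hlogz
  have hMb0 : 0 ≤ C' * (x / U ^ 2) ^ ε *
      (Real.exp (-c₉ + |K₉| / Real.log 2 ^ 10) / Real.log (x ^ θ₁ / 2)) :=
    mul_nonneg (mul_nonneg hC'0 hRε0)
      (div_nonneg (Real.exp_pos _).le ((by positivity : (0:ℝ) ≤ θ₁ * Real.log x / 2).trans hlogz))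
  exact fiS1_combine hA0 hlog1 hLL1 hKL0 hMb0 hLb hMb le_rfl

/-! ### Unconditional forms -/

/-- **FI (4.5) over the core regime, unconditionally** (the inputs (2.4), (1.13)–(1.14) are the
tree's `fi_moebius_density_cancellation_holds`, `fi_moebius_density_log_sum_holds`).
[cite: FriedlanderIwaniecASP1998, §4 (4.5)] -/
theorem fi_asp_T_estimate_core_holds : fi_asp_T_estimate_core :=
  fi_asp_T_estimate_core_of_cancellation fi_moebius_density_cancellation_holds
    fi_moebius_density_log_sum_holds

/-- **FI (5.1) over the core regime, unconditionally** (input (2.4):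
`fi_moebius_density_cancellation_holds`). [cite: FriedlanderIwaniecASP1998, §5 (5.1)] -/
theorem fi_asp_Tyz_estimate_core_holds : fi_asp_Tyz_estimate_core :=
  fi_asp_Tyz_estimate_core_of_cancellation fi_moebius_density_cancellation_holds

end Literature.NumberTheory.Sieve
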